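import Mathlib.Combinatorics.SimpleGraph.Finite
import Mathlib.Combinatorics.SimpleGraph.Connectivity.Connected
import Mathlib.Combinatorics.SimpleGraph.Maps
import Mathlib.Combinatorics.SimpleGraph.Sum
import Mathlib.Logic.Equiv.Fin.Basic
import Mathlib.Data.Real.Basic
import Literature.ModelTheory.FiniteModelTheory.CFIUncolouredStructure
import Literature.Computability.Complexity.HardcoreInapproximability
import HarnessLib

/-!
# Route PhaseTwins, support `ConstantFactorTwinsEverywhere` (stmt-PneNP-2726): definitions

Objects used by the proof of `Summit.PneNP.PneNP.Theses.PhaseTwins.ConstantFactorTwinsEverywhere`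
("for all `Δ ≥ 3`, `λ > 0`, `k` there are max-degree-`≤ Δ` graphs `G`, `H` on the same `n ≥ 1`
vertices, hom-indistinguishable over treewidth `< k`, with `Z_G(λ) ≥ 2 Z_H(λ)`"), which lands in the
sibling files `PhaseTwinsConstantFactorTwinsEverywhere{Base,Indep,Sign,Parity}.lean` and
`PhaseTwinsConstantFactorTwinsEverywhere.lean`. The proof: Cai–Fürer–Immerman graphs (tree:
`cfiGraph`) over a cubic base graph without small separators are `C^k`-equivalent (tree:
`ckEquiv_cfiEven_cfiGraph_of_separator`), have maximum degree `3`, and the even and the odd one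
have DIFFERENT hard-core partition functions at every `λ > 0`; disjoint copies then give the factor `2`.

* §1 THE BASE GRAPHS. `splitGrid m` — the `m × m` grid with every grid point split into a row
  half `(i, j, 0)` and a column half `(i, j, 1)` joined by a rung (maximum degree `3`; every
  Cai–Fürer–Immerman separator has more than `(m - 1)/2` vertices); `splitGridFin m` — the same graph
  numbered by `Fin (2 m²)` (`sgEquiv`, `splitGridFinIso`), the format of the tree's `cfiGraph`;
  `dirCode` — the direction of a neighbour (degree bookkeeping).
* §2 INDEPENDENT SETS OF CFI GRAPHS. For the signed average `Σ_T (-1)^{|T|} Z(CFI(G,T), λ)` over all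
  twist sets: oriented darts `ODart` (one per edge), `rev`, `orient`, `dartSumEquiv`; the twist set
  `twistSet τ` of a bit vector `τ` on oriented darts; the constraints cutting out the independent sets
  of `CFI(G, T)` among all vertex sets `I` — `gadgetOK` (no middle vertex of `I` sees a link of `I`)
  and `edgeOK d t` (the two connection edges over the dart `d` with twist bit `t` are respected);
  the signed edge weight `delta I d = [edgeOK d 0] - [edgeOK d 1] ∈ {0, ±1}` with its truth tables
  `eTable`, `dTable`; signs `sgn`, `eps`; the occupied bit `bitFn`; the FLIP involution `flipV d₀` /
  `flipI d₀` exchanging the two links over `d₀`; `full` (every gadget carries a middle vertex),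
  `freeVerts`, `firstDart`, `pivot` (the dart at which a non-full configuration is flipped); the
  weight `weight` of a configuration in the signed average; the reference configuration `Istar`.
* §3 COPIES. `copies N H` — `N` disjoint copies of `H` (the tree's `gadgetSubst ⊥`, so that
  `Z_{N·H} = Z_H^N` is `independencePolynomial_gadgetSubst_bot`), with the isomorphisms
  `copiesSuccIso : (N+1)·H ≅ H ⊕ N·H` and `copiesZeroIso`.

Only definitions and their unfolding / structural lemmas live here. [folklore]
-/

namespace Summit.PneNP.PneNP.PhaseTwins.ConstantFactorTwins

-- `Summit.PneNP.PneNP.…` (summit = sub-problem name) trips the duplicate-namespace linter on every declaration.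
set_option linter.dupNamespace false

open Finset
open Literature.ModelTheory.FiniteModelTheory
open Literature.Computability.Complexity (gadgetSubst gadgetSubst_bot_adj)

noncomputable section

/-! ## §1 The split grids -/

section SplitGrid

/-- Vertices of the split grid: `(i, j, l)`, row `i`, column `j`, layer `l`. -/
abbrev SGVert (m : ℕ) : Type := Fin m × Fin m × Fin 2

/-- The split grid: a graph of maximum degree `3` on `2 m²` vertices ("the `m × m` grid with
every grid point split into a row half and a column half"): row steps on layer `0`, column steps
on layer `1`, and the rung joining the two layers at each grid point. -/
def splitGrid (m : ℕ) : SimpleGraph (SGVert m) :=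
  SimpleGraph.fromRel fun a b =>
    (a.2.2 = 0 ∧ b.2.2 = 0 ∧ a.1 = b.1 ∧ (a.2.1 : ℕ) + 1 = b.2.1) ∨
    (a.2.2 = 1 ∧ b.2.2 = 1 ∧ a.2.1 = b.2.1 ∧ (a.1 : ℕ) + 1 = b.1) ∨
    (a.2.2 = 0 ∧ b.2.2 = 1 ∧ a.1 = b.1 ∧ a.2.1 = b.2.1)

/-- The standard numbering of the split-grid vertices. -/
def sgEquiv (m : ℕ) : SGVert m ≃ Fin (m * (m * 2)) :=
  ((Equiv.refl (Fin m)).prodCongr finProdFinEquiv).trans finProdFinEquiv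

/-- The split grid on the vertex set `Fin (2 m²)` (base graphs of the CFI construction must live
on `Fin v`). -/
def splitGridFin (m : ℕ) : SimpleGraph (Fin (m * (m * 2))) :=
  SimpleGraph.comap (sgEquiv m).symm (splitGrid m)

/-- The numbering is an isomorphism `splitGridFin m ≃g splitGrid m`. -/
def splitGridFinIso (m : ℕ) : splitGridFin m ≃g splitGrid m :=
  SimpleGraph.Iso.comap (sgEquiv m).symm (splitGrid m)

/-- Adjacency of the split grid is decidable (it is generated by a decidable relation). -/
instance (m : ℕ) : DecidableRel (splitGrid m).Adj := by
  unfold splitGrid; infer_instance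

/-- Adjacency of the numbered split grid is decidable (pulled back along the numbering). -/
instance (m : ℕ) : DecidableRel (splitGridFin m).Adj := by
  unfold splitGridFin; infer_instance

variable {m : ℕ}

/-- Unfolding the adjacency of the split grid (`SimpleGraph.fromRel`: the generating relation in
either direction, between distinct vertices). -/
theorem splitGrid_adj (a b : SGVert m) :
    (splitGrid m).Adj a b ↔ a ≠ b ∧
      (((a.2.2 = 0 ∧ b.2.2 = 0 ∧ a.1 = b.1 ∧ (a.2.1 : ℕ) + 1 = b.2.1) ∨
        (a.2.2 = 1 ∧ b.2.2 = 1 ∧ a.2.1 = b.2.1 ∧ (a.1 : ℕ) + 1 = b.1) ∨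
        (a.2.2 = 0 ∧ b.2.2 = 1 ∧ a.1 = b.1 ∧ a.2.1 = b.2.1)) ∨
       ((b.2.2 = 0 ∧ a.2.2 = 0 ∧ b.1 = a.1 ∧ (b.2.1 : ℕ) + 1 = a.2.1) ∨
        (b.2.2 = 1 ∧ a.2.2 = 1 ∧ b.2.1 = a.2.1 ∧ (b.1 : ℕ) + 1 = a.1) ∨
        (b.2.2 = 0 ∧ a.2.2 = 1 ∧ b.1 = a.1 ∧ b.2.1 = a.2.1))) :=
  SimpleGraph.fromRel_adj _ a b

/-- Unfolding the adjacency of the numbered split grid. -/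
theorem splitGridFin_adj (a b : Fin (m * (m * 2))) :
    (splitGridFin m).Adj a b ↔ (splitGrid m).Adj ((sgEquiv m).symm a) ((sgEquiv m).symm b) := Iff.rfl

/-- Direction code of a neighbour `b` of `a`: `2` across the rung, `0`/`1` forward/backward in the layer. -/
def dirCode (a b : SGVert m) : Fin 3 :=
  if a.2.2 ≠ b.2.2 then 2 else if (a.1 : ℕ) + a.2.1 < b.1 + b.2.1 then 0 else 1

end SplitGrid

/-! ## §2 Independent sets of CFI graphs: darts, twists, constraints, flips -/

section CFI

variable {v : ℕ} {G : SimpleGraph (Fin v)}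

variable (G) in
/-- Oriented darts `(u, w)`, `u < w`: one per edge of the base graph. -/
abbrev ODart : Type := {d : CFIDart G // d.1.1 < d.1.2}

/-- The reverse dart. -/
def rev (d : CFIDart G) : CFIDart G := ⟨(d.1.2, d.1.1), d.2.symm⟩

/-- Reversing twice is the identity. -/
@[simp] theorem rev_rev (d : CFIDart G) : rev (rev d) = d := by
  obtain ⟨⟨u, w⟩, h⟩ := d; rfl

/-- The endpoints of the reverse dart. -/
@[simp] theorem rev_fst (d : CFIDart G) : (rev d).1 = (d.1.2, d.1.1) := rfl

/-- A dart is not its own reverse (the base graph has no loops). -/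
theorem rev_ne (d : CFIDart G) : rev d ≠ d := by
  intro h
  have := congrArg (fun e : CFIDart G => e.1.1) h
  simp only [rev_fst] at this
  exact d.2.ne this.symm

/-- The twist set encoded by a Boolean vector on oriented darts. -/
def twistSet (τ : ODart G → Bool) : Set (Sym2 (Fin v)) :=
  {e | ∃ d : ODart G, τ d = true ∧ s(d.1.1.1, d.1.1.2) = e}

/-- The oriented representative of a dart. -/
def orient (d : CFIDart G) : ODart G :=
  if h : d.1.1 < d.1.2 then ⟨d, h⟩ else ⟨rev d, lt_of_le_of_ne (not_lt.1 h) fun he => d.2.ne he.symm⟩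

/-- The oriented representative of `d` is `d` or its reverse. -/
theorem orient_eq_or (d : CFIDart G) : (orient d).1 = d ∨ (orient d).1 = rev d := by
  unfold orient; split_ifs <;> simp

/-- An oriented dart lying over `d` or its reverse is the oriented representative of `d`. -/
theorem eq_orient_of_oriented {d : CFIDart G} {o : ODart G} (h : o.1 = d ∨ o.1 = rev d) :
    o = orient d := by
  have ho := o.2
  unfold orient
  split_ifs with h'
  · rcases h with h | h
    · exact Subtype.ext h
    · exfalso
      rw [h] at ho
      simp only [rev_fst] at ho
      exact lt_asymm ho h'
  · rcases h with h | h
    · exfalso; rw [h] at ho; exact h' ho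
    · exact Subtype.ext h

/-- Oriented darts and their reverses enumerate all darts. -/
def dartSumEquiv : ODart G ⊕ ODart G ≃ CFIDart G where
  toFun := Sum.elim (fun o => o.1) (fun o => rev o.1)
  invFun d := if h : d.1.1 < d.1.2 then Sum.inl ⟨d, h⟩ else Sum.inr (orient d)
  left_inv := by
    rintro (o | o)
    · simp [o.2]
    · have h : ¬ (rev o.1).1.1 < (rev o.1).1.2 := by
        simp only [rev_fst]; exact lt_asymm o.2
      simp only [Sum.elim_inr, h, dif_neg, not_false_eq_true]
      rw [← eq_orient_of_oriented (Or.inr rfl)]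
  right_inv := by
    intro d
    by_cases h : d.1.1 < d.1.2
    · simp [h]
    · simp only [h, dif_neg, not_false_eq_true, Sum.elim_inr]
      unfold orient
      rw [dif_neg h, rev_rev]

section Inst

variable [DecidableRel G.Adj]

/-- Membership in a twist set is decidable (finitely many oriented darts). -/
instance (τ : ODart G → Bool) : DecidablePred (· ∈ twistSet τ) := fun e =>
  decidable_of_iff (∃ d : ODart G, τ d = true ∧ s(d.1.1.1, d.1.1.2) = e) Iff.rfl

/-- The EDGE CONSTRAINT of a dart `d` with twist bit `t`: the vertex sets `I` in which no link
`(d, c)` of `I` is joined to the link `(rev d, c ⊕ t)` of `I`. -/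
def edgeOK (d : CFIDart G) (t : Bool) : Set (Finset (CFIVertex G)) :=
  {I | ∀ c : Bool, linkV (d, c) ∈ I → linkV (rev d, xor c t) ∉ I}

variable (G) in
/-- The GADGET CONSTRAINT: the vertex sets `I` in which no middle vertex of `I` is joined to a link
of `I`. -/
def gadgetOK : Set (Finset (CFIVertex G)) :=
  {I | ∀ x : CFIMidIdx G, midV x ∈ I → ∀ (d : CFIDart G) (c : Bool), linkV (d, c) ∈ I →
    ¬ (x.1 = d.1.1 ∧ (c = true ↔ d.1.2 ∈ x.2.1))}

/-- Unfolding `edgeOK`. -/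
theorem mem_edgeOK {d : CFIDart G} {t : Bool} {I : Finset (CFIVertex G)} :
    I ∈ edgeOK d t ↔ ∀ c : Bool, linkV (d, c) ∈ I → linkV (rev d, xor c t) ∉ I := Iff.rfl

/-- Unfolding `gadgetOK`. -/
theorem mem_gadgetOK {I : Finset (CFIVertex G)} :
    I ∈ gadgetOK G ↔ ∀ x : CFIMidIdx G, midV x ∈ I → ∀ (d : CFIDart G) (c : Bool), linkV (d, c) ∈ I →
      ¬ (x.1 = d.1.1 ∧ (c = true ↔ d.1.2 ∈ x.2.1)) := Iff.rfl

/-- The edge constraint as a Boolean function of the four membership bits `aT = [(d,1) ∈ I]`,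
`aF = [(d,0) ∈ I]`, `bT = [(rev d,1) ∈ I]`, `bF = [(rev d,0) ∈ I]` and the twist bit `t`. -/
def eTable (aT aF bT bF t : Bool) : Bool :=
  !((aT && (if t then bF else bT)) || (aF && (if t then bT else bF)))

/-- The signed edge weight table `[edge constraint, untwisted] - [edge constraint, twisted]`. -/
def dTable (aT aF bT bF : Bool) : ℤ :=
  (if eTable aT aF bT bF false then 1 else 0) - (if eTable aT aF bT bF true then 1 else 0)

/-- The signed edge weight `δ(d, I)`. -/
def delta (I : Finset (CFIVertex G)) (d : CFIDart G) : ℝ :=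
  dTable (decide (linkV (d, true) ∈ I)) (decide (linkV (d, false) ∈ I))
    (decide (linkV (rev d, true) ∈ I)) (decide (linkV (rev d, false) ∈ I))

/-- The sign of a twist bit. -/
def sgn (b : Bool) : ℝ := if b then -1 else 1

/-- `±1` according to a bit. -/
def eps (b : Bool) : ℝ := if b then 1 else -1

/-- The occupied bit of the link pair at `(u, w)` (`true` off the darts). -/
def bitFn (I : Finset (CFIVertex G)) (u w : Fin v) : Bool :=
  if h : G.Adj u w then decide (linkV (⟨(u, w), h⟩, true) ∈ I) else true

/-- The FLIP at the dart `d₀`: exchange the two links `(d₀, 0)`, `(d₀, 1)`; fix everything else. -/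
def flipV (d₀ : CFIDart G) : CFIVertex G → CFIVertex G
  | Sum.inr (d, c) => linkV (d, if d = d₀ then !c else c)
  | Sum.inl x => midV x

/-- The flip fixes middle vertices. -/
@[simp] theorem flipV_midV (d₀ : CFIDart G) (x : CFIMidIdx G) : flipV d₀ (midV x) = midV x := rfl

/-- The flip on links: the bit is complemented exactly over `d₀`. -/
@[simp] theorem flipV_linkV (d₀ d : CFIDart G) (c : Bool) :
    flipV d₀ (linkV (d, c)) = linkV (d, if d = d₀ then !c else c) := rfl

/-- The flip of a configuration. -/
def flipI (d₀ : CFIDart G) (I : Finset (CFIVertex G)) : Finset (CFIVertex G) := I.image (flipV d₀)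

variable (G) in
/-- FULL configurations: every gadget carries a middle vertex. -/
def full : Set (Finset (CFIVertex G)) := {I | ∀ u : Fin v, ∃ S, midV ⟨u, S⟩ ∈ I}

/-- Unfolding `full`. -/
theorem mem_full {I : Finset (CFIVertex G)} : I ∈ full G ↔ ∀ u : Fin v, ∃ S, midV ⟨u, S⟩ ∈ I := Iff.rfl

open scoped Classical in
/-- The weight of a configuration in the signed average `Σ_T (-1)^{|T|} Z(CFI(G,T), λ)`, rewritten as a
sum over all vertex sets: `[gadgetOK] · λ^{|I|} · Π_d δ(d, I)`. -/
def weight (lam : ℝ) (I : Finset (CFIVertex G)) : ℝ :=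
  (if I ∈ gadgetOK G then (1 : ℝ) else 0) * lam ^ I.card * ∏ d : ODart G, delta I d.1

/-- The gadgets carrying no middle vertex of `I`. -/
def freeVerts (I : Finset (CFIVertex G)) : Finset (Fin v) :=
  univ.filter fun u => ∀ S, midV ⟨u, S⟩ ∉ I

/-- The least neighbour of a vertex, as a dart. -/
def firstDart (hdeg : ∀ u : Fin v, (G.neighborFinset u).Nonempty) (u : Fin v) : CFIDart G :=
  ⟨(u, (G.neighborFinset u).min' (hdeg u)),
    (G.mem_neighborFinset u _).1 (Finset.min'_mem (G.neighborFinset u) (hdeg u))⟩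

/-- The PIVOT dart of a non-full configuration: the least free gadget and its least neighbour. -/
def pivot (hdeg : ∀ u : Fin v, (G.neighborFinset u).Nonempty) (I : Finset (CFIVertex G))
    (h : (freeVerts I).Nonempty) : CFIDart G :=
  firstDart hdeg ((freeVerts I).min' h)

/-- The reference configuration `I⋆`: all empty middle vertices and all `a`-links. -/
def Istar : Finset (CFIVertex G) :=
  (univ.image fun u : Fin v => midV ⟨u, emptyMid G u⟩) ∪ (univ.image fun d : CFIDart G => linkV (d, true))

end Inst

end CFI

/-! ## §3 Disjoint copies of a graph -/

section Copies

variable {V : Type*}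

/-- `N` disjoint copies of `H` (Sly's `Ĥ^G` with the empty graph `⊥` on the copies and no ports). -/
def copies (N : ℕ) (H : SimpleGraph V) : SimpleGraph (Fin N × V) :=
  gadgetSubst (⊥ : SimpleGraph (Fin N)) H (Function.Embedding.ofIsEmpty (α := Fin 0))
    (Function.Embedding.ofIsEmpty (α := Fin 0)) (Function.Embedding.ofIsEmpty (α := Fin N × Fin 0))

/-- Adjacency in the disjoint copies: same copy, adjacent in `H`. -/
theorem copies_adj {N : ℕ} {H : SimpleGraph V} {a b : Fin N × V} :
    (copies N H).Adj a b ↔ a.1 = b.1 ∧ H.Adj a.2 b.2 :=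
  gadgetSubst_bot_adj H _ _ _ a b

/-- Peeling off the first copy: `(N+1)·H ≅ H ⊕ N·H`. -/
def copiesSuccIso (N : ℕ) (H : SimpleGraph V) : copies (N + 1) H ≃g H ⊕g copies N H where
  toFun a := Fin.cases (Sum.inl a.2) (fun i => Sum.inr (i, a.2)) a.1
  invFun := Sum.elim (fun x => (0, x)) (fun b => (b.1.succ, b.2))
  left_inv := by
    rintro ⟨i, x⟩
    induction i using Fin.cases with
    | zero => rfl
    | succ i => rfl
  right_inv := by
    rintro (x | ⟨i, x⟩) <;> rfl
  map_rel_iff' := by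
    rintro ⟨i, x⟩ ⟨j, y⟩
    simp only [Equiv.coe_fn_mk, copies_adj]
    induction i using Fin.cases with
    | zero =>
      induction j using Fin.cases with
      | zero => simp
      | succ j => simp [(Fin.succ_ne_zero j).symm]
    | succ i =>
      induction j using Fin.cases with
      | zero => simp [(Fin.succ_ne_zero i)]
      | succ j => simp [copies_adj, Fin.succ_inj]

/-- Zero copies of anything are isomorphic. -/
def copiesZeroIso {W : Type*} (H : SimpleGraph V) (H' : SimpleGraph W) : copies 0 H ≃g copies 0 H' where
  toEquiv := Equiv.equivOfIsEmpty _ _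
  map_rel_iff' := fun {a} => isEmptyElim a.1

end Copies

end

end Summit.PneNP.PneNP.PhaseTwins.ConstantFactorTwins
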